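import Summits.Langlands.Langlands.Theses.DyadicOddResidue
import Literature.NumberTheory.GaloisRepresentations.AbsolutelyIrreducibleReduction
import Literature.RingTheory.Valuation.AlgClosedResidue

/-!
# `DyadicDihedralFM` (crux stmt-Langlands-18742, route `DyadicOddResidue`): the hypothesis
# `ρ.IsOdd` is RESIDUALLY INVISIBLE at `ℓ = 2` — every mod-2 representation has `det τ(c) = 1`
# (negative-side support, refuter cdisprove seat; small-model fact about a load-bearing
# hypothesis, sorry-free)

The crux asks for Fontaine–Mazur at `ℓ = 2` for odd `ρ : Γ_ℚ → GL₂(ℚ̄₂)` with dihedral residual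
image; the route's own "why it might fail" is that *oddness is residually invisible*: mod 2 one may
have `ρ̄(c) = 1`, so Skinner–Wiles' splitting of the pseudo-representation by `ρ(c) = diag(1,-1)`
and every "`ρ̄(c) ≠ 1` / `det ρ̄(c) = -1`"-type Taylor–Wiles hypothesis are unavailable. We certify
the precise form of this obstruction:

* `det_eq_one_of_sq_eq_one` — over a field of characteristic `2`, an involution in `GL_n` has
  determinant `1` (`det² = 1 ⇒ (det − 1)² = 0`).
* `oddness_residually_invisible` — hence for EVERY homomorphism `τ : Γ_ℚ → GL_n(k)`, `char k = 2`
  (any reduction or residual representation of any `ρ`, odd or even), and every complex conjugation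
  `c` (`IsComplexConjugation φ c`, so `c² = 1`), `det τ(c) = 1`; whereas `ρ.IsOdd` is
  `det ρ(c) = -1 ≠ 1` in `ℚ̄₂`.
* `charP_padicAlgClResidueField` — the residue field `ℤ̄_ℓ/𝔪` of `ℚ̄_ℓ`, the target of the tree's
  `FramedGaloisRep.residualRep`, has characteristic `ℓ` (`‖ℓ‖ = 1/ℓ < 1`);
  `residualRep_det_conj_eq_one` — the instance at `ℓ = 2`: `det (ρ.residualRep c) = 1` for every
  `ρ : Γ_ℚ → GL₂(ℚ̄₂)` whatsoever.

Moral for provers: the hypothesis `hodd` of `DyadicDihedralFM` imposes NO condition on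
`ρ.residualRep` (nor on any reduction); it can only be consumed `2`-adically, through `ρ(c)` itself
(an element of exact order `2` with eigenvalues `1, -1` in characteristic `0`). This file does NOT
refute the crux.
-/

noncomputable section

set_option linter.dupNamespace false

namespace Summit.Langlands.Langlands.Theorems.DyadicDihedralFM.Negative

open scoped MatrixGroups
open Literature.NumberTheory.GaloisRepresentations IsLocalRing

/-- In characteristic `2` an involution has determinant `1`: `M² = 1 ⇒ (det M)² = 1 ⇒
(det M − 1)² = 0 ⇒ det M = 1`. [folklore] -/
theorem det_eq_one_of_sq_eq_one {k : Type*} [Field k] [CharP k 2] {n : ℕ} (M : GL (Fin n) k)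
    (h : M ^ 2 = 1) : Matrix.GeneralLinearGroup.det M = 1 := by
  have hd : ((Matrix.GeneralLinearGroup.det M : kˣ) : k) ^ 2 = 1 := by
    rw [← Units.val_pow_eq_pow_val, ← map_pow, h, map_one, Units.val_one]
  have h2 : (2 : k) = 0 := CharTwo.two_eq_zero
  have hsq : (((Matrix.GeneralLinearGroup.det M : kˣ) : k) - 1) ^ 2 = 0 := by
    have e : (((Matrix.GeneralLinearGroup.det M : kˣ) : k) - 1) ^ 2 =
        ((Matrix.GeneralLinearGroup.det M : kˣ) : k) ^ 2 -
          2 * ((Matrix.GeneralLinearGroup.det M : kˣ) : k) + 1 := by ring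
    rw [e, hd, h2, zero_mul, sub_zero, ← h2]
    norm_num
  have h1 : ((Matrix.GeneralLinearGroup.det M : kˣ) : k) = 1 :=
    sub_eq_zero.1 ((pow_eq_zero_iff two_ne_zero).1 hsq)
  exact Units.val_eq_one.1 h1

/-- **Oddness is residually invisible at `ℓ = 2`.** For every homomorphism `τ : Γ_ℚ → GL_n(k)`
into a field of characteristic `2` and every complex conjugation `c`, `det τ(c) = 1`
(`c² = 1`, `IsComplexConjugation.sq_eq_one`). Contrast `ρ.IsOdd : det ρ(c) = -1 ≠ 1` in `ℚ̄₂`. -/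
theorem oddness_residually_invisible {k : Type*} [Field k] [CharP k 2] {n : ℕ}
    (τ : Field.absoluteGaloisGroup ℚ →* GL (Fin n) k) {φ : ℚ →+* ℝ}
    {c : Field.absoluteGaloisGroup ℚ} (hc : IsComplexConjugation φ c) :
    Matrix.GeneralLinearGroup.det (τ c) = 1 :=
  det_eq_one_of_sq_eq_one (τ c) (by rw [← map_pow, hc.sq_eq_one, map_one])

/-- The residue field `ℤ̄_ℓ/𝔪` of `ℚ̄_ℓ` (target of `FramedGaloisRep.residualRep`) has
characteristic `ℓ`: `‖ℓ‖ = 1/ℓ < 1`, so `ℓ ∈ 𝔪` (`mem_maximalIdeal_iff_norm_lt_one`,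
`Literature.RingTheory.Valuation.charP_residueField`). [folklore] -/
theorem charP_padicAlgClResidueField (ℓ : ℕ) [Fact ℓ.Prime] : CharP (padicAlgClResidueField ℓ) ℓ := by
  refine Literature.RingTheory.Valuation.charP_residueField (padicAlgClIntegers ℓ) ?_
  rw [mem_maximalIdeal_iff_norm_lt_one (padicAlgCl_mem_valuationSubring_iff ℓ)]
  have e : (((ℓ : ℕ) : padicAlgClIntegers ℓ) : PadicAlgCl ℓ) = (ℓ : PadicAlgCl ℓ) := by simp
  rw [e, ← PadicAlgCl.valuation_coe, PadicAlgCl.valuation_p]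
  have hℓ : (1 : ℝ) < ℓ := by exact_mod_cast (Fact.out : ℓ.Prime).one_lt
  rw [NNReal.coe_div, NNReal.coe_one, NNReal.coe_natCast]
  exact (div_lt_one (by linarith)).2 hℓ

/-- **At `ℓ = 2`, `det ρ̄(c) = 1` for every `ρ : Γ_ℚ → GL₂(ℚ̄₂)` and every complex conjugation
`c`** — the chosen residual representation `ρ.residualRep` of the crux's hypotheses carries no
trace of `ρ.IsOdd`. -/
theorem residualRep_det_conj_eq_one (ρ : FramedGaloisRep ℚ (PadicAlgCl 2) 2) {φ : ℚ →+* ℝ}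
    {c : Field.absoluteGaloisGroup ℚ} (hc : IsComplexConjugation φ c) :
    Matrix.GeneralLinearGroup.det (ρ.residualRep c) = 1 := by
  haveI : CharP (padicAlgClResidueField 2) 2 := charP_padicAlgClResidueField 2
  exact oddness_residually_invisible ρ.residualRep hc

end Summit.Langlands.Langlands.Theorems.DyadicDihedralFM.Negative

end
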